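import Mathlib
import Literature.Analysis.SpecialFunctions.BesselHeatKernelBounds
import Literature.Analysis.SpecialFunctions.BesselHeatKernelConcentration
import HarnessLib

/-!
# Green's identity for two radial heat kernels of different index

For `μ, ν ≥ 0` with `μ + ν > 0`, `τ, s, x, y > 0`, put `f(z) = q^{(ν)}_τ(x,z)`, `g(z) = q^{(μ)}_s(y,z)` (kernels of
`BesselHeatKernel.lean`, measure `z dz` on `(0,∞)`).  With `L_κ = ½(∂² + z⁻¹∂) - κ²/(2z²)` and the backward equations
`∂_τ f = L_ν f`, `∂_s g = L_μ g` (`besselHeatKernel_pde`), Green's identity on `(0,∞)` reads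
  `∫_0^∞ (-(∂_τ f) g + f (∂_s g)) z dz = (ν² - μ²)/2 · ∫_0^∞ f g z⁻¹ dz`      (`integral_green_besselHeatKernel`),
because `z(-(L_ν f)g + f(L_μ g)) = -½ (z(f′g - fg′))′ + ((ν²-μ²)/2) fg/z` and the Wronskian boundary term `z(f′g - fg′)`
vanishes at `0⁺` (`tendsto_wronskian_zero`, needs `μ + ν > 0`) and at `∞` (Gaussian decay, `tendsto_wronskian_atTop`).
Also: Gaussian product bounds and the integrability of `(∂_τ f) g z`, `f (∂_s g) z`, `f g / z` on `(0,∞)`.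
This is the `s`-derivative of the Chapman–Kolmogorov pairing `∫ q^{(ν)}_{t-s}(x,z) q^{(μ)}_s(y,z) z dz` used in the Duhamel
comparison of kernels of different index [RevuzYor1999, Ch. XI §1].

## References
* D. Revuz, M. Yor, *Continuous Martingales and Brownian Motion*, 3rd ed. (1999), Ch. XI §1. [RevuzYor1999]
-/

noncomputable section

open Filter Topology Real MeasureTheory Set
open scoped Nat BigOperators

namespace Literature.Analysis.SpecialFunctions

/-! ## Continuity in the last variable -/

section Continuity

variable {κ : ℝ}

/-- Continuity of the prefactor in `z` on `(0,∞)`. [folklore] -/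
private theorem continuousOn_besselHeatPre (hκ : 0 ≤ κ) (τ x : ℝ) :
    ContinuousOn (fun z => besselHeatPre κ τ x z) (Ioi 0) := by
  unfold besselHeatPre
  exact ((continuous_const.mul (by fun_prop)).mul
    ((Real.continuous_rpow_const hκ).comp (by fun_prop))).continuousOn

/-- `z ↦ ∂_t q^{(κ)}_τ(x,z)` is continuous on `(0,∞)`. [cite: RevuzYor1999, Ch. XI §1] -/
theorem continuousOn_besselHeatDt_right (hκ : 0 ≤ κ) (τ x : ℝ) :
    ContinuousOn (fun z => besselHeatDt κ τ x z) (Ioi 0) := by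
  unfold besselHeatDt besselHeatArg
  refine (continuousOn_besselHeatPre hκ τ x).mul ?_
  refine ContinuousOn.sub ?_ ?_
  · exact ((by fun_prop : Continuous fun z : ℝ => -(1 + κ) / τ + (x ^ 2 + z ^ 2) / (2 * τ ^ 2)).mul
      ((continuous_besselP hκ).comp (by fun_prop))).continuousOn
  · exact ((by fun_prop : Continuous fun z : ℝ => 2 * (x * z / (2 * τ)) ^ 2 / τ).mul
      ((continuous_besselP (by linarith)).comp (by fun_prop))).continuousOn

/-- `z ↦ ∂_z q^{(κ)}_τ(x,z)` is continuous on `(0,∞)`. [cite: RevuzYor1999, Ch. XI §1] -/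
theorem continuousOn_besselHeatDy_right (hκ : 0 ≤ κ) (τ x : ℝ) :
    ContinuousOn (fun z => besselHeatDy κ τ x z) (Ioi 0) := by
  unfold besselHeatDy besselHeatArg
  refine (continuousOn_besselHeatPre hκ τ x).mul (ContinuousOn.add ?_ ?_)
  · refine ContinuousOn.mul ?_ ((continuous_besselP hκ).comp (by fun_prop)).continuousOn
    exact ContinuousOn.sub (continuousOn_const.div continuousOn_id fun z hz => ne_of_gt hz) (by fun_prop)
  · refine ContinuousOn.mul ?_ ((continuous_besselP (by linarith)).comp (by fun_prop)).continuousOn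
    exact ContinuousOn.div (by fun_prop) continuousOn_id fun z hz => ne_of_gt hz

end Continuity

/-! ## Gaussian product bounds and integrability -/

section Products

variable {μ ν τ s x y : ℝ}

/-- Recentring: `e^{-(x-z)²/(2τ)} ≤ e^{x²/(2τ)} e^{-z²/(4τ)}`. [folklore] -/
private theorem exp_neg_sq_le (hτ : 0 < τ) (x z : ℝ) :
    Real.exp (-(x - z) ^ 2 / (2 * τ)) ≤ Real.exp (x ^ 2 / (2 * τ)) * Real.exp (-(1 / (4 * τ)) * z ^ 2) := by
  rw [← Real.exp_add]
  refine Real.exp_le_exp.2 ?_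
  have e1 : -(x - z) ^ 2 / (2 * τ) = (-2 * (x - z) ^ 2) / (4 * τ) := by field_simp; ring
  have e2 : x ^ 2 / (2 * τ) + -(1 / (4 * τ)) * z ^ 2 = (2 * x ^ 2 - z ^ 2) / (4 * τ) := by field_simp; ring
  rw [e1, e2]
  exact div_le_div_of_nonneg_right (by nlinarith [sq_nonneg (2 * x - z)]) (by positivity)

/-- **Product bound**: `f(z) g(z) ≤ C · z^{μ+ν} e^{-z²/(4τ)}` for the two kernels. [cite: RevuzYor1999, Ch. XI §1] -/
theorem besselHeatKernel_mul_le (hμ : 0 ≤ μ) (hν : 0 ≤ ν) (hτ : 0 < τ) (hs : 0 < s) (hx : 0 < x) (hy : 0 < y)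
    {z : ℝ} (hz : 0 < z) :
    besselHeatKernel ν τ x z * besselHeatKernel μ s y z ≤
      ((τ⁻¹ * (x / (2 * τ)) ^ ν * Real.exp (x ^ 2 / (2 * τ)) / Real.Gamma (ν + 1)) *
        (s⁻¹ * (y / (2 * s)) ^ μ / Real.Gamma (μ + 1))) * (z ^ (μ + ν) * Real.exp (-(1 / (4 * τ)) * z ^ 2)) := by
  have hf := besselHeatKernel_le hν hτ hx.le hz.le
  have hg := besselHeatKernel_le hμ hs hy.le hz.le
  have hGν : 0 < Real.Gamma (ν + 1) := Real.Gamma_pos_of_pos (by linarith)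
  have hGμ : 0 < Real.Gamma (μ + 1) := Real.Gamma_pos_of_pos (by linarith)
  have h1 : (x * z / (2 * τ)) ^ ν = (x / (2 * τ)) ^ ν * z ^ ν := by
    rw [show x * z / (2 * τ) = (x / (2 * τ)) * z by ring, Real.mul_rpow (by positivity) hz.le]
  have h2 : (y * z / (2 * s)) ^ μ = (y / (2 * s)) ^ μ * z ^ μ := by
    rw [show y * z / (2 * s) = (y / (2 * s)) * z by ring, Real.mul_rpow (by positivity) hz.le]
  have h3 := exp_neg_sq_le hτ x z
  have h4 : Real.exp (-(y - z) ^ 2 / (2 * s)) ≤ 1 := by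
    rw [Real.exp_le_one_iff]; apply div_nonpos_of_nonpos_of_nonneg <;> [nlinarith [sq_nonneg (y - z)]; positivity]
  have hzpow : z ^ ν * z ^ μ = z ^ (μ + ν) := by rw [← Real.rpow_add hz]; ring_nf
  have hf0 : 0 ≤ besselHeatKernel ν τ x z := (besselHeatKernel_pos hν hτ hx hz).le
  calc besselHeatKernel ν τ x z * besselHeatKernel μ s y z
      ≤ (τ⁻¹ * (x * z / (2 * τ)) ^ ν * Real.exp (-(x - z) ^ 2 / (2 * τ)) / Real.Gamma (ν + 1)) *
          (s⁻¹ * (y * z / (2 * s)) ^ μ * Real.exp (-(y - z) ^ 2 / (2 * s)) / Real.Gamma (μ + 1)) :=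
        mul_le_mul hf hg (besselHeatKernel_pos hμ hs hy hz).le (by positivity)
    _ ≤ (τ⁻¹ * (x * z / (2 * τ)) ^ ν * (Real.exp (x ^ 2 / (2 * τ)) * Real.exp (-(1 / (4 * τ)) * z ^ 2)) / Real.Gamma (ν + 1)) *
          (s⁻¹ * (y * z / (2 * s)) ^ μ * 1 / Real.Gamma (μ + 1)) := by
        gcongr
    _ = _ := by rw [h1, h2, ← hzpow]; ring

/-- `f g / z` is integrable on `(0,∞)` when `μ + ν > 0`. [cite: RevuzYor1999, Ch. XI §1] -/
theorem integrableOn_besselHeatKernel_mul_div (hμ : 0 ≤ μ) (hν : 0 ≤ ν) (hμν : 0 < μ + ν) (hτ : 0 < τ) (hs : 0 < s)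
    (hx : 0 < x) (hy : 0 < y) :
    IntegrableOn (fun z => besselHeatKernel ν τ x z * besselHeatKernel μ s y z / z) (Ioi 0) := by
  set C : ℝ := (τ⁻¹ * (x / (2 * τ)) ^ ν * Real.exp (x ^ 2 / (2 * τ)) / Real.Gamma (ν + 1)) *
    (s⁻¹ * (y / (2 * s)) ^ μ / Real.Gamma (μ + 1)) with hC
  have hdom : IntegrableOn (fun z : ℝ => C * (z ^ (μ + ν - 1) * Real.exp (-(1 / (4 * τ)) * z ^ 2))) (Ioi 0) :=
    (integrableOn_rpow_mul_exp_neg_mul_sq (b := 1 / (4 * τ)) (by positivity) (s := μ + ν - 1) (by linarith)).const_mul C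
  refine Integrable.mono' hdom ?_ ?_
  · exact (((continuous_besselHeatKernel_right hν τ x).continuousOn.mul
      (continuous_besselHeatKernel_right hμ s y).continuousOn).div continuousOn_id
      fun z hz => ne_of_gt hz).aestronglyMeasurable measurableSet_Ioi
  · refine ae_restrict_of_forall_mem measurableSet_Ioi fun z hz => ?_
    have hz' : (0 : ℝ) < z := hz
    have hnn : 0 ≤ besselHeatKernel ν τ x z * besselHeatKernel μ s y z :=
      mul_nonneg (besselHeatKernel_pos hν hτ hx hz').le (besselHeatKernel_pos hμ hs hy hz').le
    rw [Real.norm_eq_abs, abs_of_nonneg (div_nonneg hnn hz'.le), div_le_iff₀ hz']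
    have h := besselHeatKernel_mul_le hμ hν hτ hs hx hy hz'
    have hzpow : z ^ (μ + ν - 1) * z = z ^ (μ + ν) := by
      rw [Real.rpow_sub_one hz'.ne']; field_simp
    calc besselHeatKernel ν τ x z * besselHeatKernel μ s y z
        ≤ C * (z ^ (μ + ν) * Real.exp (-(1 / (4 * τ)) * z ^ 2)) := h
      _ = C * (z ^ (μ + ν - 1) * Real.exp (-(1 / (4 * τ)) * z ^ 2)) * z := by rw [← hzpow]; ring

/-- `(∂_τ f) g z` is integrable on `(0,∞)`. [cite: RevuzYor1999, Ch. XI §1] -/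
theorem integrableOn_besselHeatDt_mul (hμ : 0 ≤ μ) (hν : 0 ≤ ν) (hτ : 0 < τ) (hs : 0 < s) (hx : 0 < x) (hy : 0 < y) :
    IntegrableOn (fun z => besselHeatDt ν τ x z * besselHeatKernel μ s y z * z) (Ioi 0) := by
  set C : ℝ := (τ⁻¹ * (x / (2 * τ)) ^ ν * Real.exp (x ^ 2 / (2 * τ)) / Real.Gamma (ν + 1)) *
    (s⁻¹ * (y / (2 * s)) ^ μ / Real.Gamma (μ + 1)) with hC
  set A : ℝ := (1 + ν) / τ + x ^ 2 / (2 * τ ^ 2) with hA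
  set B : ℝ := 1 / (2 * τ ^ 2) + x ^ 2 / (2 * τ ^ 3) with hB
  have hdom : IntegrableOn (fun z : ℝ => C * (A * (z ^ (μ + ν + 1) * Real.exp (-(1 / (4 * τ)) * z ^ 2))
      + B * (z ^ (μ + ν + 3) * Real.exp (-(1 / (4 * τ)) * z ^ 2)))) (Ioi 0) := by
    refine Integrable.const_mul (Integrable.add ?_ ?_) C
    · exact (integrableOn_rpow_mul_exp_neg_mul_sq (b := 1 / (4 * τ)) (by positivity) (s := μ + ν + 1)
        (by linarith)).const_mul A
    · exact (integrableOn_rpow_mul_exp_neg_mul_sq (b := 1 / (4 * τ)) (by positivity) (s := μ + ν + 3)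
        (by linarith)).const_mul B
  refine Integrable.mono' hdom ?_ ?_
  · exact (((continuousOn_besselHeatDt_right hν τ x).mul
      (continuous_besselHeatKernel_right hμ s y).continuousOn).mul continuousOn_id).aestronglyMeasurable
      measurableSet_Ioi
  · refine ae_restrict_of_forall_mem measurableSet_Ioi fun z hz => ?_
    have hz' : (0 : ℝ) < z := hz
    have hg0 : 0 ≤ besselHeatKernel μ s y z := (besselHeatKernel_pos hμ hs hy hz').le
    have hdt := abs_besselHeatDt_le hν hτ hx hz'
    have hprod := besselHeatKernel_mul_le hμ hν hτ hs hx hy hz'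
    have hR : (1 + ν) / τ + (x ^ 2 + z ^ 2) / (2 * τ ^ 2) + 2 * besselHeatArg τ x z / τ = A + B * z ^ 2 := by
      unfold besselHeatArg; rw [hA, hB]; field_simp; ring
    rw [hR] at hdt
    rw [Real.norm_eq_abs, abs_mul, abs_mul, abs_of_nonneg hg0, abs_of_pos hz']
    have hz1 : z ^ (μ + ν) * z = z ^ (μ + ν + 1) := by rw [Real.rpow_add_one hz'.ne']
    have hz3 : z ^ (μ + ν) * z * z ^ 2 = z ^ (μ + ν + 3) := by
      rw [show μ + ν + 3 = (μ + ν) + ((3 : ℕ) : ℝ) by push_cast; ring, Real.rpow_add hz' (μ + ν) ((3 : ℕ) : ℝ),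
        Real.rpow_natCast]; ring
    calc |besselHeatDt ν τ x z| * besselHeatKernel μ s y z * z
        ≤ (besselHeatKernel ν τ x z * (A + B * z ^ 2)) * besselHeatKernel μ s y z * z := by
          gcongr
      _ = (besselHeatKernel ν τ x z * besselHeatKernel μ s y z) * ((A + B * z ^ 2) * z) := by ring
      _ ≤ (C * (z ^ (μ + ν) * Real.exp (-(1 / (4 * τ)) * z ^ 2))) * ((A + B * z ^ 2) * z) :=
          mul_le_mul_of_nonneg_right hprod (by positivity)
      _ = C * (A * (z ^ (μ + ν + 1) * Real.exp (-(1 / (4 * τ)) * z ^ 2))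
            + B * (z ^ (μ + ν + 3) * Real.exp (-(1 / (4 * τ)) * z ^ 2))) := by
          rw [← hz1, ← hz3]; ring

/-- `f (∂_s g) z` is integrable on `(0,∞)`. [cite: RevuzYor1999, Ch. XI §1] -/
theorem integrableOn_mul_besselHeatDt (hμ : 0 ≤ μ) (hν : 0 ≤ ν) (hτ : 0 < τ) (hs : 0 < s) (hx : 0 < x) (hy : 0 < y) :
    IntegrableOn (fun z => besselHeatKernel ν τ x z * besselHeatDt μ s y z * z) (Ioi 0) := by
  have h := integrableOn_besselHeatDt_mul (μ := ν) (ν := μ) hν hμ hs hτ hy hx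
  refine h.congr_fun (fun z _ => ?_) measurableSet_Ioi
  ring

end Products

/-! ## The Wronskian boundary term at infinity and its derivative -/

section Wronskian

variable {μ ν τ s x y : ℝ}

/-- `z^p e^{-c z²} → 0` as `z → ∞` (`c > 0`). [folklore] -/
private theorem tendsto_rpow_mul_exp_neg_mul_sq {p c : ℝ} (hc : 0 < c) :
    Tendsto (fun z : ℝ => z ^ p * Real.exp (-c * z ^ 2)) atTop (𝓝 0) := by
  have h := tendsto_rpow_mul_exp_neg_mul_atTop_nhds_zero p c hc
  refine tendsto_of_tendsto_of_tendsto_of_le_of_le' tendsto_const_nhds h ?_ ?_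
  · filter_upwards [eventually_ge_atTop 0] with z hz
    exact mul_nonneg (Real.rpow_nonneg hz p) (Real.exp_nonneg _)
  · filter_upwards [eventually_ge_atTop 1] with z hz
    refine mul_le_mul_of_nonneg_left (Real.exp_le_exp.2 ?_) (Real.rpow_nonneg (by linarith) p)
    nlinarith [mul_nonneg (mul_nonneg hc.le (by linarith : (0 : ℝ) ≤ z)) (by linarith : (0 : ℝ) ≤ z - 1)]

/-- **The Wronskian boundary term vanishes at infinity**: `z(f′g - fg′) → 0` as `z → ∞` (Gaussian decay).
[cite: RevuzYor1999, Ch. XI §1] -/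
theorem tendsto_wronskian_atTop (hμ : 0 ≤ μ) (hν : 0 ≤ ν) (hτ : 0 < τ) (hs : 0 < s) (hx : 0 < x) (hy : 0 < y) :
    Tendsto (fun z : ℝ => z * (besselHeatDy ν τ x z * besselHeatKernel μ s y z
      - besselHeatKernel ν τ x z * besselHeatDy μ s y z)) atTop (𝓝 0) := by
  set C : ℝ := (τ⁻¹ * (x / (2 * τ)) ^ ν * Real.exp (x ^ 2 / (2 * τ)) / Real.Gamma (ν + 1)) *
    (s⁻¹ * (y / (2 * s)) ^ μ / Real.Gamma (μ + 1)) with hC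
  set a : ℝ := (1 / τ + x ^ 2 / (2 * τ ^ 2)) + (1 / s + y ^ 2 / (2 * s ^ 2)) with ha
  -- bound `|W(z)| ≤ C ((ν+μ) z^{μ+ν} e^{-z²/4τ} + a z^{μ+ν+2} e^{-z²/4τ})` for `z > 0`
  have hbound : ∀ z : ℝ, 0 < z →
      |z * (besselHeatDy ν τ x z * besselHeatKernel μ s y z - besselHeatKernel ν τ x z * besselHeatDy μ s y z)| ≤
        C * ((ν + μ) * (z ^ (μ + ν) * Real.exp (-(1 / (4 * τ)) * z ^ 2))
          + a * (z ^ (μ + ν + 2) * Real.exp (-(1 / (4 * τ)) * z ^ 2))) := by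
    intro z hz
    have hf0 : 0 ≤ besselHeatKernel ν τ x z := (besselHeatKernel_pos hν hτ hx hz).le
    have hg0 : 0 ≤ besselHeatKernel μ s y z := (besselHeatKernel_pos hμ hs hy hz).le
    have hf1 := abs_besselHeatDy_le hν hτ hx hz
    have hg1 := abs_besselHeatDy_le hμ hs hy hz
    have hprod := besselHeatKernel_mul_le hμ hν hτ hs hx hy hz
    have eRf : z * (ν / z + z / τ + 2 * besselHeatArg τ x z / z) = ν + (1 / τ + x ^ 2 / (2 * τ ^ 2)) * z ^ 2 := by
      unfold besselHeatArg; field_simp; ring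
    have eRg : z * (μ / z + z / s + 2 * besselHeatArg s y z / z) = μ + (1 / s + y ^ 2 / (2 * s ^ 2)) * z ^ 2 := by
      unfold besselHeatArg; field_simp; ring
    rw [abs_mul, abs_of_pos hz]
    have hz2 : z ^ (μ + ν) * z ^ 2 = z ^ (μ + ν + 2) := by
      rw [show μ + ν + 2 = (μ + ν) + ((2 : ℕ) : ℝ) by push_cast; ring, Real.rpow_add hz (μ + ν) ((2 : ℕ) : ℝ),
        Real.rpow_natCast]
    calc z * |besselHeatDy ν τ x z * besselHeatKernel μ s y z - besselHeatKernel ν τ x z * besselHeatDy μ s y z|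
        ≤ z * (|besselHeatDy ν τ x z| * besselHeatKernel μ s y z + besselHeatKernel ν τ x z * |besselHeatDy μ s y z|) := by
          refine mul_le_mul_of_nonneg_left ((abs_sub _ _).trans ?_) hz.le
          rw [abs_mul, abs_mul, abs_of_nonneg hg0, abs_of_nonneg hf0]
      _ ≤ z * ((besselHeatKernel ν τ x z * (ν / z + z / τ + 2 * besselHeatArg τ x z / z)) * besselHeatKernel μ s y z
            + besselHeatKernel ν τ x z * (besselHeatKernel μ s y z * (μ / z + z / s + 2 * besselHeatArg s y z / z))) := by
          gcongr
      _ = (besselHeatKernel ν τ x z * besselHeatKernel μ s y z) *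
            (z * (ν / z + z / τ + 2 * besselHeatArg τ x z / z) + z * (μ / z + z / s + 2 * besselHeatArg s y z / z)) := by
          ring
      _ ≤ (C * (z ^ (μ + ν) * Real.exp (-(1 / (4 * τ)) * z ^ 2))) *
            (z * (ν / z + z / τ + 2 * besselHeatArg τ x z / z) + z * (μ / z + z / s + 2 * besselHeatArg s y z / z)) := by
          refine mul_le_mul_of_nonneg_right hprod ?_
          rw [eRf, eRg]; positivity
      _ = C * ((ν + μ) * (z ^ (μ + ν) * Real.exp (-(1 / (4 * τ)) * z ^ 2))
          + a * (z ^ (μ + ν + 2) * Real.exp (-(1 / (4 * τ)) * z ^ 2))) := by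
          rw [eRf, eRg, ha, ← hz2]; ring
  have hlim : Tendsto (fun z : ℝ => C * ((ν + μ) * (z ^ (μ + ν) * Real.exp (-(1 / (4 * τ)) * z ^ 2))
      + a * (z ^ (μ + ν + 2) * Real.exp (-(1 / (4 * τ)) * z ^ 2)))) atTop (𝓝 0) := by
    have h1 := tendsto_rpow_mul_exp_neg_mul_sq (p := μ + ν) (c := 1 / (4 * τ)) (by positivity)
    have h2 := tendsto_rpow_mul_exp_neg_mul_sq (p := μ + ν + 2) (c := 1 / (4 * τ)) (by positivity)
    have := ((h1.const_mul (ν + μ)).add (h2.const_mul a)).const_mul C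
    simpa using this
  refine squeeze_zero_norm' ?_ hlim
  filter_upwards [eventually_gt_atTop 0] with z hz
  rw [Real.norm_eq_abs]
  exact hbound z hz

/-- **Derivative of the Wronskian term**: with `W(z) = z(f′g - fg′)`, the backward equations give
`W′(z) = 2z((∂_τ f)g - f(∂_s g)) + (ν² - μ²) fg/z` for `z > 0`. [cite: RevuzYor1999, Ch. XI §1] -/
theorem hasDerivAt_wronskian (hμ : 0 ≤ μ) (hν : 0 ≤ ν) (hτ : 0 < τ) (hs : 0 < s) (hx : 0 < x) (hy : 0 < y)
    {z : ℝ} (hz : 0 < z) :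
    HasDerivAt (fun z : ℝ => z * (besselHeatDy ν τ x z * besselHeatKernel μ s y z
        - besselHeatKernel ν τ x z * besselHeatDy μ s y z))
      (2 * z * (besselHeatDt ν τ x z * besselHeatKernel μ s y z - besselHeatKernel ν τ x z * besselHeatDt μ s y z)
        + (ν ^ 2 - μ ^ 2) * (besselHeatKernel ν τ x z * besselHeatKernel μ s y z / z)) z := by
  have hf := hasDerivAt_besselHeatKernel_y hν hτ hx hz
  have hf1 := hasDerivAt_besselHeatDy_y hν hτ hx hz
  have hg := hasDerivAt_besselHeatKernel_y hμ hs hy hz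
  have hg1 := hasDerivAt_besselHeatDy_y hμ hs hy hz
  have h := (hasDerivAt_id z).mul ((hf1.mul hg).sub (hf.mul hg1))
  refine h.congr_deriv ?_
  have pf := besselHeatKernel_pde hν hτ hx hz
  have pg := besselHeatKernel_pde hμ hs hy hz
  simp only [id, one_mul, Pi.mul_apply, Pi.sub_apply]
  -- eliminate the second derivatives with the backward equations
  have ef : besselHeatDyy ν τ x z = 2 * besselHeatDt ν τ x z - besselHeatDy ν τ x z / z
      + ν ^ 2 / z ^ 2 * besselHeatKernel ν τ x z := by
    have hz' := hz.ne'
    field_simp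
    field_simp at pf
    linarith
  have eg : besselHeatDyy μ s y z = 2 * besselHeatDt μ s y z - besselHeatDy μ s y z / z
      + μ ^ 2 / z ^ 2 * besselHeatKernel μ s y z := by
    have hz' := hz.ne'
    field_simp
    field_simp at pg
    linarith
  rw [ef, eg]
  have hz' := hz.ne'
  field_simp
  ring

end Wronskian

/-! ## Green's identity -/

section Green

variable {μ ν τ s x y : ℝ}

/-- **Green's identity for two radial heat kernels**: for `μ, ν ≥ 0`, `μ + ν > 0`, `τ, s, x, y > 0`,
`∫_0^∞ (-(∂_τ q^{(ν)}_τ)(x,z) q^{(μ)}_s(y,z) + q^{(ν)}_τ(x,z) (∂_s q^{(μ)}_s)(y,z)) z dz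
  = (ν² - μ²)/2 · ∫_0^∞ q^{(ν)}_τ(x,z) q^{(μ)}_s(y,z) z⁻¹ dz`. [cite: RevuzYor1999, Ch. XI §1] -/
theorem integral_green_besselHeatKernel (hμ : 0 ≤ μ) (hν : 0 ≤ ν) (hμν : 0 < μ + ν) (hτ : 0 < τ) (hs : 0 < s)
    (hx : 0 < x) (hy : 0 < y) :
    ∫ z in Ioi (0 : ℝ), (-(besselHeatDt ν τ x z) * besselHeatKernel μ s y z
        + besselHeatKernel ν τ x z * besselHeatDt μ s y z) * z =
      (ν ^ 2 - μ ^ 2) / 2 * ∫ z in Ioi (0 : ℝ), besselHeatKernel ν τ x z * besselHeatKernel μ s y z / z := by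
  -- abbreviations
  set W : ℝ → ℝ := fun z => z * (besselHeatDy ν τ x z * besselHeatKernel μ s y z
    - besselHeatKernel ν τ x z * besselHeatDy μ s y z) with hW
  set W' : ℝ → ℝ := fun z => 2 * z * (besselHeatDt ν τ x z * besselHeatKernel μ s y z
    - besselHeatKernel ν τ x z * besselHeatDt μ s y z)
    + (ν ^ 2 - μ ^ 2) * (besselHeatKernel ν τ x z * besselHeatKernel μ s y z / z) with hW'
  -- integrability of the pieces
  have hI1 := integrableOn_besselHeatDt_mul hμ hν hτ hs hx hy
  have hI2 := integrableOn_mul_besselHeatDt hμ hν hτ hs hx hy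
  have hI3 := integrableOn_besselHeatKernel_mul_div hμ hν hμν hτ hs hx hy
  have hW'int : IntegrableOn W' (Ioi 0) := by
    have h : IntegrableOn (fun z => 2 * (besselHeatDt ν τ x z * besselHeatKernel μ s y z * z
        - besselHeatKernel ν τ x z * besselHeatDt μ s y z * z)
        + (ν ^ 2 - μ ^ 2) * (besselHeatKernel ν τ x z * besselHeatKernel μ s y z / z)) (Ioi 0) :=
      ((hI1.sub hI2).const_mul 2).add (hI3.const_mul _)
    refine h.congr_fun (fun z _ => ?_) measurableSet_Ioi
    simp only [hW']
    ring
  -- `∫ W' = 0`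
  have hFTC : ∫ z in Ioi (0 : ℝ), W' z = 0 := by
    have hcont : ContinuousWithinAt W (Ici 0) 0 := by
      rw [← continuousWithinAt_Ioi_iff_Ici]
      have h0 : W 0 = 0 := by simp [hW]
      rw [ContinuousWithinAt, h0]
      exact tendsto_wronskian_zero hμ hν hμν hτ hs hx hy
    have hderiv : ∀ z ∈ Ioi (0 : ℝ), HasDerivAt W (W' z) z := fun z hz =>
      hasDerivAt_wronskian hμ hν hτ hs hx hy hz
    have hlim : Tendsto W atTop (𝓝 0) := tendsto_wronskian_atTop hμ hν hτ hs hx hy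
    have h := integral_Ioi_of_hasDerivAt_of_tendsto hcont hderiv hW'int hlim
    have h0 : W 0 = 0 := by simp [hW]
    rw [h, h0, sub_zero]
  -- pointwise: integrand = -½ W' + ((ν²-μ²)/2) fg/z
  have hpt : ∀ z ∈ Ioi (0 : ℝ), (-(besselHeatDt ν τ x z) * besselHeatKernel μ s y z
        + besselHeatKernel ν τ x z * besselHeatDt μ s y z) * z =
      (-(1 / 2 : ℝ)) * W' z + (ν ^ 2 - μ ^ 2) / 2 * (besselHeatKernel ν τ x z * besselHeatKernel μ s y z / z) := by
    intro z hz
    have hz' : (0 : ℝ) < z := hz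
    simp only [hW']
    field_simp
    ring
  rw [setIntegral_congr_fun measurableSet_Ioi hpt, integral_add (hW'int.const_mul _) (hI3.const_mul _),
    integral_const_mul, integral_const_mul, hFTC]
  ring

end Green

end Literature.Analysis.SpecialFunctions

end
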